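import Literature.Analysis.Complex.LaurentExpansionGerms
import Mathlib.RingTheory.MvPolynomial.Basic
import HarnessLib

/-!
# Germs of curves with meromorphic coordinates: pole bookkeeping and vanishing near `0`

Topic `Literature/Analysis/Complex` (namespace `Literature.Analysis.Complex.MeromorphicGerm`).
Small tools for analytic branches `t ↦ γ(t) ∈ ℂ^ι` whose coordinates are meromorphic at
`t = 0` in the concrete form "`t^K · γ_k(t)` is analytic at `0`" (the hypothesis format of
`LaurentExpansionGerms.lean`). PROVED, no definition:

* `analyticAt_pow_succ_mul_div_pow`, `analyticAt_pow_succ_mul_inv_pow` — the coordinates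
  `Φ(t)/t^N` (`Φ` analytic) and `t^{-e}` have this form;
* `exists_analyticAt_pow_mul_aeval` — so does every polynomial in the coordinates;
* `exists_radius_eq_zero` — a germ of this form vanishing frequently near `0` vanishes on a
  whole punctured disc (isolated zeros);
* `frequently_nhdsNE_of_forall_exists`, `ne_zero_and_norm_lt_of_pow_eq_inv` — filter and
  norm bookkeeping for parameters `t = u^{-1/e}`, `|u| → ∞`.

[folklore]
-/

noncomputable section

open Complex Filter Topology Set Metric

namespace Literature.Analysis.Complex

namespace MeromorphicGerm

open Literature.Analysis.Complex.LaurentGerm (analyticAt_pow_add analyticAt_mul analyticAt_add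
  analyticAt_const_mul laurent_inv_pow eventuallyEq_zero_of_puncture)

/-- `t^{N+1} · (Φ(t)/t^N) = t Φ(t)` is analytic at `0` for `Φ` analytic at `0` (the identity holds
at `t = 0` too, thanks to `0⁻¹ = 0`). [folklore] -/
theorem analyticAt_pow_succ_mul_div_pow {Φ : ℂ → ℂ} (hΦ : AnalyticAt ℂ Φ 0) (N : ℕ) :
    AnalyticAt ℂ (fun t : ℂ => t ^ (N + 1) * (Φ t / t ^ N)) 0 := by
  have hfun : (fun t : ℂ => t ^ (N + 1) * (Φ t / t ^ N)) = fun t => t * Φ t := by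
    funext t
    by_cases ht : t = 0
    · subst ht; simp
    · field_simp
      ring
  rw [hfun]
  exact analyticAt_id.mul hΦ

/-- `t^{e+1} · t^{-e} = t` is analytic at `0`. [folklore] -/
theorem analyticAt_pow_succ_mul_inv_pow (e : ℕ) :
    AnalyticAt ℂ (fun t : ℂ => t ^ (e + 1) * (t ^ e)⁻¹) 0 :=
  (laurent_inv_pow e).2

/-- **Polynomials in meromorphic coordinates are meromorphic**: if every coordinate `γ_k` has
`t^{K_k} γ_k(t)` analytic at `0`, then for every polynomial `p` some `t^K · p(γ(t))` is
analytic at `0`. [folklore] -/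
theorem exists_analyticAt_pow_mul_aeval {ι : Type*} (γ : ℂ → ι → ℂ)
    (hγ : ∀ k, ∃ K : ℕ, AnalyticAt ℂ (fun t : ℂ => t ^ K * γ t k) 0) (p : MvPolynomial ι ℂ) :
    ∃ K : ℕ, AnalyticAt ℂ (fun t : ℂ => t ^ K * MvPolynomial.aeval (γ t) p) 0 := by
  induction p using MvPolynomial.induction_on with
  | C a =>
    refine ⟨0, ?_⟩
    simp only [pow_zero, one_mul, MvPolynomial.algHom_C, Algebra.algebraMap_self, RingHom.id_apply]
    exact analyticAt_const
  | add p q hp hq =>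
    obtain ⟨K₁, h₁⟩ := hp
    obtain ⟨K₂, h₂⟩ := hq
    have h₁' := analyticAt_pow_add h₁ K₂
    have h₂' := analyticAt_pow_add h₂ K₁
    rw [Nat.add_comm K₂ K₁] at h₂'
    refine ⟨K₁ + K₂, ?_⟩
    have := analyticAt_add h₁' h₂'
    simpa only [map_add] using this
  | mul_X p k hp =>
    obtain ⟨K₁, h₁⟩ := hp
    obtain ⟨K₂, h₂⟩ := hγ k
    refine ⟨K₁ + K₂, ?_⟩
    have := analyticAt_mul h₁ h₂
    simpa only [map_mul, MvPolynomial.aeval_X] using this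

/-- **Frequent zeros near `0` fill a punctured disc.** If `t^K F(t)` is analytic at `0` and `F`
vanishes frequently on punctured neighbourhoods of `0`, then `F = 0` on some punctured disc.
[folklore] -/
theorem exists_radius_eq_zero {F : ℂ → ℂ} {K : ℕ} (hF : AnalyticAt ℂ (fun t : ℂ => t ^ K * F t) 0)
    (hfr : ∃ᶠ t in 𝓝[≠] (0 : ℂ), F t = 0) :
    ∃ δ > 0, ∀ t : ℂ, 0 < ‖t‖ → ‖t‖ < δ → F t = 0 := by
  have hfr' : ∃ᶠ t in 𝓝[≠] (0 : ℂ), t ^ K * F t = 0 :=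
    hfr.mono fun t ht => by rw [ht, mul_zero]
  have hev : ∀ᶠ t in 𝓝 (0 : ℂ), t ^ K * F t = 0 := hF.frequently_zero_iff_eventually_zero.1 hfr'
  have hev' : ∀ᶠ t in 𝓝[≠] (0 : ℂ), F t = 0 := by
    have h1 : ∀ᶠ t in 𝓝[≠] (0 : ℂ), t ^ K * F t = 0 := eventually_nhdsWithin_of_eventually_nhds hev
    filter_upwards [h1, self_mem_nhdsWithin] with t ht ht0
    exact (mul_eq_zero.1 ht).resolve_left (pow_ne_zero K ht0)
  obtain ⟨δ, hδ, h⟩ := (Metric.nhdsWithin_basis_ball (s := ({0}ᶜ : Set ℂ)) (x := 0)).eventually_iff.1 hev'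
  refine ⟨δ, hδ, fun t ht htδ => h ⟨?_, ?_⟩⟩
  · rwa [mem_ball_zero_iff]
  · rw [Set.mem_compl_iff, Set.mem_singleton_iff]; exact fun h0 => by
      rw [h0, norm_zero] at ht; exact lt_irrefl 0 ht

/-- Frequently near `0` from witnesses in every small punctured disc. [folklore] -/
theorem frequently_nhdsNE_of_forall_exists {P : ℂ → Prop}
    (h : ∀ ε > 0, ∃ t : ℂ, 0 < ‖t‖ ∧ ‖t‖ < ε ∧ P t) : ∃ᶠ t in 𝓝[≠] (0 : ℂ), P t := by
  rw [(Metric.nhdsWithin_basis_ball (s := ({0}ᶜ : Set ℂ)) (x := 0)).frequently_iff]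
  intro ε hε
  obtain ⟨t, ht0, htε, hP⟩ := h ε hε
  refine ⟨t, ⟨by rwa [mem_ball_zero_iff], ?_⟩, hP⟩
  rw [Set.mem_compl_iff, Set.mem_singleton_iff]
  intro h0; rw [h0, norm_zero] at ht0; exact lt_irrefl 0 ht0

/-- **Parameters at infinity are small**: if `tᵉ = u⁻¹` and `|u| > δ⁻ᵉ` then `0 < |t| < δ`.
[folklore] -/
theorem ne_zero_and_norm_lt_of_pow_eq_inv {t u : ℂ} {e : ℕ} {δ : ℝ} (he : 0 < e) (hδ : 0 < δ)
    (ht : t ^ e = u⁻¹) (hu : δ⁻¹ ^ e < ‖u‖) : t ≠ 0 ∧ ‖t‖ < δ := by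
  have hu0 : u ≠ 0 := by
    rintro rfl; rw [norm_zero] at hu
    exact absurd hu (not_lt.2 (by positivity))
  have ht0 : t ≠ 0 := by
    rintro rfl; rw [zero_pow he.ne'] at ht; exact inv_ne_zero hu0 ht.symm
  refine ⟨ht0, ?_⟩
  have h1 : ‖t‖ ^ e = ‖u‖⁻¹ := by rw [← norm_pow, ht, norm_inv]
  have h2 : ‖u‖⁻¹ < δ ^ e := by
    rw [inv_pow] at hu
    exact inv_lt_of_inv_lt₀ (pow_pos hδ e) hu
  exact lt_of_pow_lt_pow_left₀ e hδ.le (h1 ▸ h2)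

end MeromorphicGerm

end Literature.Analysis.Complex

end
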